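import Literature.Probability.Percolation.TileCells
import Literature.Probability.Percolation.LatticeFaceParity
import Literature.Probability.LatticeModels.CornerPotential
import HarnessLib

/-!
# The tile domain of an explored collar: cells, membership, tameness and pinch-freeness

Topic `Probability/Percolation`.  Sixth step of the cell-complex toolkit for the gluing theorem
(Schramm–Smirnov 2011, proof of Thm 1.5, step (C)).  The link domain of the gluing argument is the
closure of the fresh region `M′` (tube ∪ bay interiors) in tile geometry (`TileCells.lean`).  Here it
is built from abstract **tile data** — hub (beach) vertices `O`, examined-open edges `hubE`,
examined-closed edges `clE`, dual-wet faces `Dset`, accessible fresh edges `acc` and the window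
vertex set `Wv` — subject to the axioms delivered by the seeded explorer at terminality
(`SeededFrontier.lean`, `SeededClosure.lean`, `GluingStructure.lean`): accessibility closure at
non-hub vertices, `T3` (no wet face has a hub corner with both face sides accessible), connectivity
of the accessible edges and the four escape properties used for hole-freeness.

* `TileData`, its cell set `TileData.U` (site cells of accessible non-hub vertices, bond cells of
  accessible edges, face cells of non-wet faces with an accessible side) and the membership lemmas
  `σc_mem_U_iff`, `bcell_mem_U_iff`, `φc_mem_U_iff` (parities separate the three kinds);
* `TileData.isPreconnected_edge_inter` — **primal tameness**: every drawn lattice edge meets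
  `K = Kset U` in a preconnected set;
* `TileData.pinchFree` — **no checkerboard corner** (patterns A and B of `TileCells` are excluded by
  closure and the wetness of closed edges' faces, and by `T3` respectively);
* `TileData.edgeConn` — **edge-connectedness** (accessible edges are connected through non-hub
  vertices; every cell hangs on the bond cell of an accessible edge);
* `TileData.coHoleFree` — **no holes**: every out-cell adjacent to the domain escapes through
  out-cells to arbitrarily far cells (hub cells along examined open edges, wet faces and examined
  closed edges along the dual flood, pocket edges to one of these, and off through the outside of the
  window).

With `CellQuad.exists_cellQuad` these make the tile domain, with any four marked traced vertices, a
`Quad` whose carrier is the union of its closed cells.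

Everything is proved; no named fact is introduced.

## References

* O. Schramm, S. Smirnov, Ann. Probab. 39 (2011), arXiv:1101.5820, proof of Thm 1.5 (C). [SchrammSmirnov2011]
* G. Grimmett, *Percolation* (1999), §11.2 (planar duality). [GrimmettPercolation1999]
-/

noncomputable section

open Set Metric
open Literature.Probability.LatticeModels

namespace Literature.Probability.Percolation

namespace CellComplex

/-! ### Edges and faces in dart form -/

/-- The lattice edge from `w` in direction `k`. [folklore] -/
def dartEdge (w : Site 2) (k : Fin 4) : Sym2 (Site 2) := s(w, w + cornerUnit k)

/-- Reversing the dart gives the same edge. [folklore] -/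
theorem dartEdge_rev (w : Site 2) (k : Fin 4) : dartEdge (w + cornerUnit k) (k + 2) = dartEdge w k := by
  rw [dartEdge, dartEdge, cornerUnit_add_two, show w + cornerUnit k + -cornerUnit k = w by abel, Sym2.eq_swap]

/-- Dart edges are lattice edges. [folklore] -/
theorem dartEdge_mem_edgeSet (w : Site 2) (k : Fin 4) : dartEdge w k ∈ (zdGraph 2).edgeSet := by
  rw [dartEdge, mem_edgeSet_zdGraph_iff]
  fin_cases k
  · exact ⟨w, 0, rfl⟩
  · exact ⟨w, 1, rfl⟩
  · refine ⟨w + cornerUnit 2, 0, ?_⟩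
    rw [Sym2.eq_swap]; congr 1; simp [cornerUnit]
  · refine ⟨w + cornerUnit 3, 1, ?_⟩
    rw [Sym2.eq_swap]; congr 1; simp [cornerUnit]

/-- Every lattice edge is a dart edge. [folklore] -/
theorem exists_dartEdge_eq {e : Sym2 (Site 2)} (he : e ∈ (zdGraph 2).edgeSet) :
    ∃ (w : Site 2) (k : Fin 4), e = dartEdge w k := by
  obtain ⟨u, i, rfl⟩ := mem_edgeSet_zdGraph_iff.1 he
  fin_cases i
  · exact ⟨u, 0, rfl⟩
  · exact ⟨u, 1, rfl⟩

/-- Membership of the endpoints. [folklore] -/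
theorem mem_dartEdge_iff {w v : Site 2} {k : Fin 4} : v ∈ dartEdge w k ↔ v = w ∨ v = w + cornerUnit k :=
  Sym2.mem_iff

/-- Faces of the horizontal edge `{u, u + e₀}`. [folklore] -/
theorem isFaceOf_horiz_iff {u f : Site 2} :
    IsFaceOf f s(u, u + Pi.single 0 1) ↔ f = u - Pi.single 1 1 ∨ f = u :=
  isFaceOf_single_iff (i := 0) (j := 1) (by decide)

/-- Faces of the vertical edge `{u, u + e₁}`. [folklore] -/
theorem isFaceOf_vert_iff {u f : Site 2} :
    IsFaceOf f s(u, u + Pi.single 1 1) ↔ f = u - Pi.single 0 1 ∨ f = u :=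
  isFaceOf_single_iff (i := 1) (j := 0) (by decide)

/-- **The faces of a dart edge** are the cells `faceAt w k` (left) and `faceAt w (k + 3)` (right). [folklore] -/
theorem isFaceOf_dartEdge_iff {w f : Site 2} {k : Fin 4} :
    IsFaceOf f (dartEdge w k) ↔ f = faceAt w k ∨ f = faceAt w (k + 3) := by
  match k with
  | 0 =>
    rw [dartEdge, show cornerUnit 0 = Pi.single 0 1 from rfl, isFaceOf_horiz_iff,
      show (0 : Fin 4) + 3 = 3 from rfl]
    have h0 : faceAt w 0 = w := by simp [faceAt, cornerOff]
    have h3 : faceAt w 3 = w - Pi.single 1 1 := by simp [faceAt, cornerOff]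
    rw [h0, h3]; tauto
  | 1 =>
    rw [dartEdge, show cornerUnit 1 = Pi.single 1 1 from rfl, isFaceOf_vert_iff,
      show (1 : Fin 4) + 3 = 0 from rfl]
    have h0 : faceAt w 0 = w := by simp [faceAt, cornerOff]
    have h1 : faceAt w 1 = w - Pi.single 0 1 := by simp [faceAt, cornerOff]
    rw [h0, h1]
  | 2 =>
    have e2 : dartEdge w 2 = s(w + cornerUnit 2, (w + cornerUnit 2) + Pi.single 0 1) := by
      rw [dartEdge, Sym2.eq_swap]; congr 1; simp [cornerUnit]
    rw [e2, isFaceOf_horiz_iff, show (2 : Fin 4) + 3 = 1 from rfl]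
    have h2 : faceAt w 2 = w + cornerUnit 2 - Pi.single 1 1 := by
      simp [faceAt, cornerOff, cornerUnit, sub_eq_add_neg]; abel
    have h1 : faceAt w 1 = w + cornerUnit 2 := by simp [faceAt, cornerOff, cornerUnit, sub_eq_add_neg]
    rw [h2, h1]
  | 3 =>
    have e3 : dartEdge w 3 = s(w + cornerUnit 3, (w + cornerUnit 3) + Pi.single 1 1) := by
      rw [dartEdge, Sym2.eq_swap]; congr 1; simp [cornerUnit]
    rw [e3, isFaceOf_vert_iff, show (3 : Fin 4) + 3 = 2 from rfl]
    have h3 : faceAt w 3 = w + cornerUnit 3 := by simp [faceAt, cornerOff, cornerUnit, sub_eq_add_neg]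
    have h2 : faceAt w 2 = w + cornerUnit 3 - Pi.single 0 1 := by
      simp [faceAt, cornerOff, cornerUnit, sub_eq_add_neg]; abel
    rw [h3, h2]; tauto

/-! ### Cells of edges and faces -/

/-- The bond cell of an edge: for `e = {a, b}` it is `a + b` (twice the midpoint). [folklore] -/
def bcell : Sym2 (Site 2) → Site 2 := Sym2.lift ⟨fun a b => a + b, fun a b => add_comm a b⟩

/-- The bond cell of a dart edge is `βc`. [folklore] -/
@[simp] theorem bcell_dartEdge (w : Site 2) (k : Fin 4) : bcell (dartEdge w k) = βc w k := by
  rw [dartEdge, bcell, Sym2.lift_mk]; simp only; rw [βc]; abel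

/-- Parity of site cells: both coordinates even. [folklore] -/
theorem σc_even (v : Site 2) (i : Fin 2) : Even (σc v i) := ⟨v i, by rw [σc_apply, two_mul]⟩

/-- Parity of face cells: both coordinates odd. [folklore] -/
theorem φc_odd (f : Site 2) (i : Fin 2) : Odd (φc f i) := ⟨f i, by rw [φc_apply]⟩

/-- Parity of bond cells: the coordinate across the edge is even, along it odd; in particular some
coordinate is odd and some is even. [folklore] -/
theorem βc_parity (v : Site 2) (k : Fin 4) : (∃ i, Odd (βc v k i)) ∧ ∃ i, Even (βc v k i) := by
  fin_cases k
  · exact ⟨⟨0, ⟨v 0, by rw [βc_apply]; simp [cornerUnit]⟩⟩, ⟨1, ⟨v 1, by rw [βc_apply]; simp [cornerUnit, two_mul]⟩⟩⟩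
  · exact ⟨⟨1, ⟨v 1, by rw [βc_apply]; simp [cornerUnit]⟩⟩, ⟨0, ⟨v 0, by rw [βc_apply]; simp [cornerUnit, two_mul]⟩⟩⟩
  · exact ⟨⟨0, ⟨v 0 - 1, by rw [βc_apply]; simp [cornerUnit]; ring⟩⟩, ⟨1, ⟨v 1, by rw [βc_apply]; simp [cornerUnit, two_mul]⟩⟩⟩
  · exact ⟨⟨1, ⟨v 1 - 1, by rw [βc_apply]; simp [cornerUnit]; ring⟩⟩, ⟨0, ⟨v 0, by rw [βc_apply]; simp [cornerUnit, two_mul]⟩⟩⟩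

/-- Site cells are not bond cells. [folklore] -/
theorem σc_ne_βc (v w : Site 2) (k : Fin 4) : σc v ≠ βc w k := by
  intro h
  obtain ⟨⟨i, hi⟩, -⟩ := βc_parity w k
  rw [← h] at hi
  exact (Int.not_odd_iff_even.2 (σc_even v i)) hi

/-- Site cells are not face cells. [folklore] -/
theorem σc_ne_φc (v f : Site 2) : σc v ≠ φc f := by
  intro h
  have := φc_odd f 0
  rw [← h] at this
  exact (Int.not_odd_iff_even.2 (σc_even v 0)) this

/-- Bond cells are not face cells. [folklore] -/
theorem βc_ne_φc (w f : Site 2) (k : Fin 4) : βc w k ≠ φc f := by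
  intro h
  obtain ⟨-, ⟨i, hi⟩⟩ := βc_parity w k
  rw [h] at hi
  exact (Int.not_even_iff_odd.2 (φc_odd f i)) hi

/-- `σc` is injective. [folklore] -/
theorem σc_injective : Function.Injective σc := by
  intro v w h
  funext i
  have := congr_fun h i
  rw [σc_apply, σc_apply] at this
  omega

/-- `φc` is injective. [folklore] -/
theorem φc_injective : Function.Injective φc := by
  intro f g h
  funext i
  have := congr_fun h i
  rw [φc_apply, φc_apply] at this
  omega

/-- `bcell` is injective on lattice edges. [folklore] -/
theorem bcell_injOn : InjOn bcell (zdGraph 2).edgeSet := by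
  intro e he e' he' h
  obtain ⟨w, k, rfl⟩ := exists_dartEdge_eq he
  obtain ⟨w', k', rfl⟩ := exists_dartEdge_eq he'
  rw [bcell_dartEdge, bcell_dartEdge] at h
  -- compare coordinates: `2w + u_k = 2w' + u_k'`
  have h0 := congr_fun h 0
  have h1 := congr_fun h 1
  rw [βc_apply, βc_apply] at h0 h1
  rw [dartEdge, dartEdge]
  fin_cases k <;> fin_cases k' <;> simp [cornerUnit] at h0 h1 ⊢
  all_goals first
    | (left; funext i; fin_cases i <;> simp <;> omega)
    | (right; constructor <;> (funext i; fin_cases i <;> simp <;> omega))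


/-! ### Tile data and the cell set -/

/-- The two endpoints of an edge as a finset. [folklore] -/
def endpts : Sym2 (Site 2) → Finset (Site 2) :=
  Sym2.lift ⟨fun a b => {a, b}, fun a b => Finset.pair_comm a b⟩

/-- Membership in `endpts`. [folklore] -/
@[simp] theorem mem_endpts_iff {e : Sym2 (Site 2)} {v : Site 2} : v ∈ endpts e ↔ v ∈ e := by
  induction e using Sym2.ind with
  | h a b => simp [endpts, Sym2.lift_mk]

/-- The faces of an edge as a finset (the endpoints of its dual edge). [folklore] -/
def facesOf (e : Sym2 (Site 2)) : Finset (Site 2) := endpts (dualEdge e)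

/-- Membership in `facesOf`. [folklore] -/
@[simp] theorem mem_facesOf_iff {e : Sym2 (Site 2)} {f : Site 2} : f ∈ facesOf e ↔ IsFaceOf f e := by
  rw [facesOf, mem_endpts_iff, IsFaceOf]

/-- **Tile data** of an explored collar at terminality: hub (beach) vertices `O`, examined-open edges
`hubE`, examined-closed edges `clE`, dual-wet faces `Dset`, the finite set `acc` of accessible fresh
edges and the window vertex set `Wv`, with the axioms delivered by the seeded explorer.
[cite: SchrammSmirnov2011, proof of Thm 1.5 (C)] -/
structure TileData where
  /-- hub (beach) vertices -/
  O : Set (Site 2)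
  /-- examined open edges -/
  hubE : Set (Sym2 (Site 2))
  /-- examined closed edges -/
  clE : Set (Sym2 (Site 2))
  /-- dual-wet faces -/
  Dset : Set (Site 2)
  /-- accessible fresh edges -/
  acc : Finset (Sym2 (Site 2))
  /-- window vertices -/
  Wv : Set (Site 2)
  /-- accessible edges are lattice edges -/
  acc_edge : ∀ e ∈ acc, e ∈ (zdGraph 2).edgeSet
  /-- accessible edges lie in the window -/
  acc_window : ∀ e ∈ acc, ∀ v ∈ e, v ∈ Wv
  /-- accessible edges are fresh: not examined open -/
  acc_not_hub : ∀ e ∈ acc, e ∉ hubE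
  /-- accessible edges are fresh: not examined closed -/
  acc_not_cl : ∀ e ∈ acc, e ∉ clE
  /-- examined open edges are lattice edges -/
  hub_edge : ∀ e ∈ hubE, e ∈ (zdGraph 2).edgeSet
  /-- examined open edges join hub vertices -/
  hub_O : ∀ e ∈ hubE, ∀ v ∈ e, v ∈ O
  /-- examined closed edges have a hub endpoint -/
  cl_O : ∀ e ∈ clE, ∃ v ∈ e, v ∈ O
  /-- the faces of an examined closed edge are wet -/
  cl_D : ∀ e ∈ clE, ∀ f, IsFaceOf f e → f ∈ Dset
  /-- accessibility closure at accessible non-hub vertices: every window edge there is examined or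
  accessible -/
  closure : ∀ e ∈ acc, ∀ w ∈ e, w ∉ O → ∀ e' ∈ (zdGraph 2).edgeSet, w ∈ e' → (∀ v ∈ e', v ∈ Wv) →
    e' ∈ hubE ∨ e' ∈ clE ∨ e' ∈ acc
  /-- terminality at hub corners of wet faces: the two sides of a wet face at a hub corner are not
  both accessible (on the collar one of them would be eligible) -/
  T3 : ∀ f ∈ Dset, ∀ w ∈ O, ∀ e₁ ∈ acc, ∀ e₂ ∈ acc, e₁ ≠ e₂ → w ∈ e₁ → w ∈ e₂ →
    IsFaceOf f e₁ → IsFaceOf f e₂ → False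
  /-- accessible edges have a non-hub endpoint -/
  acc_nonO : ∀ e ∈ acc, ∃ w ∈ e, w ∉ O
  /-- accessible edges are connected through shared non-hub vertices -/
  acc_conn : ∀ e ∈ acc, ∀ e' ∈ acc,
    Relation.ReflTransGen (fun a b => a ∈ acc ∧ b ∈ acc ∧ ∃ w, w ∈ a ∧ w ∈ b ∧ w ∉ O) e e'
  /-- outside the window one can walk off to infinity -/
  esc_W : ∀ u ∉ Wv, ∀ R : ℝ, ∃ u', R < ‖Site.toComplex u'‖ ∧
    Relation.ReflTransGen (fun a b => a ∉ Wv ∧ b ∉ Wv ∧ ∃ k, b = a + cornerUnit k) u u'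
  /-- hub vertices are joined to the outside of the window by examined open edges -/
  esc_O : ∀ v ∈ O, ∃ u ∉ Wv, Relation.ReflTransGen (fun a b => s(a, b) ∈ hubE) v u
  /-- wet faces are joined, across examined closed edges and through wet faces, to a face with a
  corner outside the window -/
  esc_D : ∀ f ∈ Dset, ∃ g, (∃ u ∉ Wv, TouchesFace u g) ∧
    Relation.ReflTransGen
      (fun a b => b ∈ Dset ∧ ∃ c ∈ clE, c ∈ (zdGraph 2).edgeSet ∧ IsFaceOf a c ∧ IsFaceOf b c) f g
  /-- pocket edges (window edges neither examined nor accessible) are joined through window pocket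
  edges to a window pocket edge with an endpoint that is a hub vertex, or carries an examined closed
  edge, or is next to the outside of the window -/
  esc_P : ∀ e ∈ (zdGraph 2).edgeSet, (∀ v ∈ e, v ∈ Wv) → e ∉ hubE → e ∉ clE → e ∉ acc →
    ∃ e' u, u ∈ e' ∧
      (u ∈ O ∨ (∃ c ∈ clE, c ∈ (zdGraph 2).edgeSet ∧ u ∈ c) ∨ (∃ k, u + cornerUnit k ∉ Wv)) ∧
      Relation.ReflTransGen (fun a b => b ∈ (zdGraph 2).edgeSet ∧ (∀ v ∈ b, v ∈ Wv) ∧ b ∉ hubE ∧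
        b ∉ clE ∧ b ∉ acc ∧ ∃ u, u ∈ a ∧ u ∈ b) e e'

namespace TileData

variable (𝒯 : TileData)

/-- Accessible vertices: endpoints of accessible edges. [folklore] -/
def accVerts : Finset (Site 2) := 𝒯.acc.biUnion endpts

/-- Membership in `accVerts`. [folklore] -/
theorem mem_accVerts_iff {v : Site 2} : v ∈ 𝒯.accVerts ↔ ∃ e ∈ 𝒯.acc, v ∈ e := by
  simp [accVerts]

/-- Domain faces: non-wet faces with an accessible side. [folklore] -/
def domFaces : Finset (Site 2) := by
  classical exact (𝒯.acc.biUnion facesOf).filter fun f => f ∉ 𝒯.Dset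

/-- Membership in `domFaces`. [folklore] -/
theorem mem_domFaces_iff {f : Site 2} : f ∈ 𝒯.domFaces ↔ f ∉ 𝒯.Dset ∧ ∃ e ∈ 𝒯.acc, IsFaceOf f e := by
  classical
  simp only [domFaces, Finset.mem_filter, Finset.mem_biUnion, mem_facesOf_iff]
  tauto

/-- **The cell set of the tile domain**: site cells of accessible non-hub vertices, bond cells of
accessible edges, face cells of domain faces. [cite: SchrammSmirnov2011, proof of Thm 1.5 (C)] -/
def U : Finset (Site 2) := by
  classical exact
    ((𝒯.accVerts.filter fun v => v ∉ 𝒯.O).image σc) ∪ (𝒯.acc.image bcell) ∪ (𝒯.domFaces.image φc)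

/-- Membership of a site cell. [folklore] -/
theorem σc_mem_U_iff {v : Site 2} : σc v ∈ 𝒯.U ↔ v ∉ 𝒯.O ∧ ∃ e ∈ 𝒯.acc, v ∈ e := by
  classical
  simp only [U, Finset.mem_union, Finset.mem_image, Finset.mem_filter, mem_accVerts_iff]
  constructor
  · rintro ((⟨w, ⟨hw, hwO⟩, hwv⟩ | ⟨e, he, hev⟩) | ⟨f, -, hfv⟩)
    · rw [σc_injective hwv] at hw hwO; exact ⟨hwO, hw⟩
    · obtain ⟨w, k, rfl⟩ := exists_dartEdge_eq (𝒯.acc_edge e he)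
      rw [bcell_dartEdge] at hev
      exact absurd hev.symm (σc_ne_βc v w k)
    · exact absurd hfv.symm (σc_ne_φc v f)
  · rintro ⟨hvO, hv⟩
    exact Or.inl (Or.inl ⟨v, ⟨hv, hvO⟩, rfl⟩)

/-- Membership of a bond cell. [folklore] -/
theorem bcell_mem_U_iff {e : Sym2 (Site 2)} (he : e ∈ (zdGraph 2).edgeSet) : bcell e ∈ 𝒯.U ↔ e ∈ 𝒯.acc := by
  classical
  obtain ⟨w, k, rfl⟩ := exists_dartEdge_eq he
  simp only [U, Finset.mem_union, Finset.mem_image, Finset.mem_filter, bcell_dartEdge]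
  constructor
  · rintro ((⟨v, -, hv⟩ | ⟨e', he', hev⟩) | ⟨f, -, hfv⟩)
    · exact absurd hv (σc_ne_βc v w k)
    · have : e' = dartEdge w k :=
        bcell_injOn (𝒯.acc_edge e' he') (dartEdge_mem_edgeSet w k) (by rw [hev, bcell_dartEdge])
      rw [← this]; exact he'
    · exact absurd hfv (βc_ne_φc w f k).symm
  · intro h
    exact Or.inl (Or.inr ⟨dartEdge w k, h, bcell_dartEdge w k⟩)

/-- Membership of the bond cell of a dart edge. [folklore] -/
theorem βc_mem_U_iff {w : Site 2} {k : Fin 4} : βc w k ∈ 𝒯.U ↔ dartEdge w k ∈ 𝒯.acc := by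
  rw [← bcell_dartEdge, 𝒯.bcell_mem_U_iff (dartEdge_mem_edgeSet w k)]

/-- Membership of a face cell. [folklore] -/
theorem φc_mem_U_iff {f : Site 2} : φc f ∈ 𝒯.U ↔ f ∉ 𝒯.Dset ∧ ∃ e ∈ 𝒯.acc, IsFaceOf f e := by
  classical
  rw [← mem_domFaces_iff]
  simp only [U, Finset.mem_union, Finset.mem_image, Finset.mem_filter]
  constructor
  · rintro ((⟨v, -, hv⟩ | ⟨e', he', hev⟩) | ⟨f', hf', hfv⟩)
    · exact absurd hv (σc_ne_φc v f)
    · obtain ⟨w, k, rfl⟩ := exists_dartEdge_eq (𝒯.acc_edge e' he')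
      rw [bcell_dartEdge] at hev
      exact absurd hev (βc_ne_φc w f k)
    · rw [φc_injective hfv] at hf'; exact hf'
  · intro h
    exact Or.inr ⟨f, h, rfl⟩

/-! ### Primal tameness -/

/-- **No slit**: if both site cells of a dart edge are in `U`, so is its bond cell. [cite: SchrammSmirnov2011, proof of Thm 1.5 (C)] -/
theorem βc_mem_of_σc_mem {w : Site 2} {k : Fin 4} (h1 : σc w ∈ 𝒯.U) (h2 : σc (w + cornerUnit k) ∈ 𝒯.U) :
    βc w k ∈ 𝒯.U := by
  rw [σc_mem_U_iff] at h1 h2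
  obtain ⟨hwO, e, he, hwe⟩ := h1
  obtain ⟨hw'O, e', he', hw'e'⟩ := h2
  rw [βc_mem_U_iff]
  have hwin : ∀ v ∈ dartEdge w k, v ∈ 𝒯.Wv := by
    intro v hv
    rcases mem_dartEdge_iff.1 hv with rfl | rfl
    · exact 𝒯.acc_window e he _ hwe
    · exact 𝒯.acc_window e' he' _ hw'e'
  rcases 𝒯.closure e he w hwe hwO (dartEdge w k) (dartEdge_mem_edgeSet w k)
      (mem_dartEdge_iff.2 (Or.inl rfl)) hwin with h | h | h
  · exact absurd (𝒯.hub_O _ h w (mem_dartEdge_iff.2 (Or.inl rfl))) hwO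
  · obtain ⟨v, hv, hvO⟩ := 𝒯.cl_O _ h
    rcases mem_dartEdge_iff.1 hv with rfl | rfl
    · exact absurd hvO hwO
    · exact absurd hvO hw'O
  · exact h

/-- **Inner sites**: a bond cell of `U` at a site outside `U` has its far site in `U` (the
accessible edge has a non-hub endpoint, which is not the near one). [folklore] -/
theorem σc_far_mem_of_βc_mem {w : Site 2} {k : Fin 4} (h1 : σc w ∉ 𝒯.U) (h2 : βc w k ∈ 𝒯.U) :
    σc (w + cornerUnit k) ∈ 𝒯.U := by
  rw [βc_mem_U_iff] at h2
  obtain ⟨v, hv, hvO⟩ := 𝒯.acc_nonO _ h2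
  rcases mem_dartEdge_iff.1 hv with rfl | rfl
  · exact absurd ((σc_mem_U_iff 𝒯).2 ⟨hvO, _, h2, hv⟩) h1
  · exact (σc_mem_U_iff 𝒯).2 ⟨hvO, _, h2, hv⟩

/-- **Primal tameness of the tile domain**: every drawn lattice edge meets `K` in a preconnected
set. [cite: SchrammSmirnov2011, proof of Lemma 6.1 (lattice-tame quads)] -/
theorem isPreconnected_edge_inter (w : Site 2) (k : Fin 4) :
    IsPreconnected (segment ℝ (ctr (σc w)) (ctr (σc (w + cornerUnit k))) ∩ Kset 𝒯.U) :=
  isPreconnected_edge_inter_Kset 𝒯.U w k fun h1 h2 => 𝒯.βc_mem_of_σc_mem h1 h2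

/-! ### Pinch-freeness -/

end TileData

/-- The two sides of the face `faceAt w (j + 2)` at `w` are the dart edges in directions `j + 2` and
`j + 3`. [folklore] -/
theorem isFaceOf_faceAt_add_two (w : Site 2) (j : Fin 4) :
    IsFaceOf (faceAt w (j + 2)) (dartEdge w (j + 2)) ∧ IsFaceOf (faceAt w (j + 2)) (dartEdge w (j + 3)) := by
  refine ⟨isFaceOf_dartEdge_iff.2 (Or.inl rfl), isFaceOf_dartEdge_iff.2 (Or.inr ?_)⟩
  rw [fin4_add_three_add_three]

/-- Distinct directions give distinct dart edges. [folklore] -/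
theorem dartEdge_ne_of_ne (w : Site 2) {k k' : Fin 4} (h : k ≠ k') : dartEdge w k ≠ dartEdge w k' := by
  intro heq
  have := congrArg bcell heq
  rw [bcell_dartEdge, bcell_dartEdge, βc, βc] at this
  exact h (cornerUnit_injective (add_left_cancel this))

/-- The `m`-th side of the face `F`: the dart edge from the corner `F + cornerOff m` in direction
`m`. [folklore] -/
def faceSide (F : Site 2) (m : Fin 4) : Sym2 (Site 2) := dartEdge (F + cornerOff m) m

/-- **The edges of which `F` is a face are its four sides.** [folklore] -/
theorem isFaceOf_iff_exists_faceSide {F : Site 2} {e : Sym2 (Site 2)} (he : e ∈ (zdGraph 2).edgeSet) :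
    IsFaceOf F e ↔ ∃ m : Fin 4, e = faceSide F m := by
  constructor
  · intro hF
    obtain ⟨w₀, k₀, rfl⟩ := exists_dartEdge_eq he
    rcases isFaceOf_dartEdge_iff.1 hF with h | h
    · refine ⟨k₀, ?_⟩
      rw [faceSide, h, faceAt]; congr 1; abel
    · refine ⟨k₀ + 2, ?_⟩
      rw [faceSide, ← dartEdge_rev (F + cornerOff (k₀ + 2)) (k₀ + 2), fin4_add_two_add_two', h, faceAt]
      congr 1
      rw [cornerUnit_eq_off_sub, fin4_add_two_add_one]; abel
  · rintro ⟨m, rfl⟩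
    rw [faceSide, isFaceOf_dartEdge_iff, faceAt_add_cornerOff]
    exact Or.inl rfl

/-- The sides of `faceAt w (j + 2)`: two contain `w` (directions `j + 2`, `j + 3` at `w`), the other
two contain `w + u_{j+2}` resp. `w + u_{j+3}`. [folklore] -/
theorem faceSide_faceAt_cases (w : Site 2) (j i : Fin 4) :
    (i = 2 ∧ faceSide (faceAt w (j + 2)) (j + i) = dartEdge w (j + 2)) ∨
    (i = 1 ∧ faceSide (faceAt w (j + 2)) (j + i) = dartEdge w (j + 3)) ∨
    (i = 3 ∧ w + cornerUnit (j + 2) ∈ faceSide (faceAt w (j + 2)) (j + i)) ∨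
    (i = 0 ∧ w + cornerUnit (j + 3) ∈ faceSide (faceAt w (j + 2)) (j + i)) := by
  have h3 : cornerUnit (j + 3) = -(cornerOff (j + 2) - cornerOff (j + 1)) := by
    rw [show j + 3 = j + 1 + 2 from (fin4_add_one_add_two j).symm, cornerUnit_add_two, cornerUnit_eq_off_sub,
      fin4_add_one_add_one]
  fin_cases i
  · right; right; right
    refine ⟨rfl, ?_⟩
    simp only [Fin.zero_eta, add_zero]
    rw [faceSide, mem_dartEdge_iff]
    right
    rw [h3, faceAt, cornerUnit_eq_off_sub j]
    abel
  · right; left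
    refine ⟨rfl, ?_⟩
    simp only [Fin.mk_one]
    rw [faceSide, ← dartEdge_rev w (j + 3), DiscreteDobrushin.fin4_three_two]
    congr 1
    rw [h3, faceAt]; abel
  · left
    refine ⟨rfl, ?_⟩
    simp only [Fin.reduceFinMk]
    rw [faceSide, faceAt]
    congr 1; abel
  · right; right; left
    refine ⟨rfl, ?_⟩
    simp only [Fin.reduceFinMk]
    rw [faceSide, mem_dartEdge_iff]
    left
    rw [faceAt, cornerUnit_eq_off_sub, fin4_add_two_add_one]; abel

namespace TileData

variable (𝒯 : TileData)

/-- **Pattern A is excluded** (closure and terminality). [cite: SchrammSmirnov2011, proof of Thm 1.5 (C)] -/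
theorem not_patternA (w : Site 2) (j : Fin 4) : ¬ PatternA 𝒯.U w j := by
  rintro ⟨hS, hF, hB2, hB3⟩
  rw [σc_mem_U_iff] at hS
  obtain ⟨hwO, e, he, hwe⟩ := hS
  rw [φc_mem_U_iff] at hF
  obtain ⟨hfD, e₀, he₀, hfe₀⟩ := hF
  rw [βc_mem_U_iff] at hB2 hB3
  obtain ⟨hf2, hf3⟩ := isFaceOf_faceAt_add_two w j
  -- each of the two sides at `w`, not being accessible, leaves the window
  have side : ∀ k : Fin 4, IsFaceOf (faceAt w (j + 2)) (dartEdge w k) → dartEdge w k ∉ 𝒯.acc →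
      w + cornerUnit k ∉ 𝒯.Wv := by
    intro k hfk hk hwin
    have hall : ∀ v ∈ dartEdge w k, v ∈ 𝒯.Wv := by
      intro v hv
      rcases mem_dartEdge_iff.1 hv with rfl | rfl
      · exact 𝒯.acc_window e he _ hwe
      · exact hwin
    rcases 𝒯.closure e he w hwe hwO (dartEdge w k) (dartEdge_mem_edgeSet w k)
        (mem_dartEdge_iff.2 (Or.inl rfl)) hall with h | h | h
    · exact hwO (𝒯.hub_O _ h w (mem_dartEdge_iff.2 (Or.inl rfl)))
    · exact hfD (𝒯.cl_D _ h _ hfk)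
    · exact hk h
  have h2 := side (j + 2) hf2 hB2
  have h3 := side (j + 3) hf3 hB3
  -- the accessible side `e₀` is one of the four sides
  obtain ⟨m, hm⟩ := (isFaceOf_iff_exists_faceSide (𝒯.acc_edge e₀ he₀)).1 hfe₀
  obtain ⟨i, rfl⟩ := fin4_exists_add j m
  have hwin₀ : ∀ v ∈ e₀, v ∈ 𝒯.Wv := 𝒯.acc_window _ he₀
  rcases faceSide_faceAt_cases w j i with ⟨-, hs⟩ | ⟨-, hs⟩ | ⟨-, hs⟩ | ⟨-, hs⟩
  · exact hB2 (by rw [← hs, ← hm]; exact he₀)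
  · exact hB3 (by rw [← hs, ← hm]; exact he₀)
  · exact h2 (hwin₀ _ (by rw [hm]; exact hs))
  · exact h3 (hwin₀ _ (by rw [hm]; exact hs))

/-- **Pattern B is excluded** (`T3`: the two sides of a wet face at a hub corner are not both
accessible). [cite: SchrammSmirnov2011, proof of Thm 1.5 (C)] -/
theorem not_patternB (w : Site 2) (j : Fin 4) : ¬ PatternB 𝒯.U w j := by
  rintro ⟨hB2, hB3, hS, hF⟩
  rw [βc_mem_U_iff] at hB2 hB3
  obtain ⟨hf2, hf3⟩ := isFaceOf_faceAt_add_two w j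
  -- `w` is accessible, hence a hub vertex
  have hwO : w ∈ 𝒯.O := by
    by_contra hwO
    exact hS ((σc_mem_U_iff 𝒯).2 ⟨hwO, _, hB2, mem_dartEdge_iff.2 (Or.inl rfl)⟩)
  -- the face is wet (else it would be a domain face)
  have hfD : faceAt w (j + 2) ∈ 𝒯.Dset := by
    by_contra hfD
    exact hF ((φc_mem_U_iff 𝒯).2 ⟨hfD, _, hB2, hf2⟩)
  have hne : j + 2 ≠ j + 3 := fun h => absurd (add_left_cancel h) (by decide)
  exact 𝒯.T3 _ hfD w hwO _ hB2 _ hB3 (dartEdge_ne_of_ne w hne)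
    (mem_dartEdge_iff.2 (Or.inl rfl)) (mem_dartEdge_iff.2 (Or.inl rfl)) hf2 hf3

/-- **The tile domain is pinch-free.** [cite: SchrammSmirnov2011, proof of Thm 1.5 (C)] -/
theorem pinchFree : PinchFree 𝒯.U :=
  pinchFree_of_patterns (fun w j => 𝒯.not_patternA w j) (fun w j => 𝒯.not_patternB w j)

/-! ### Edge-connectedness -/

end TileData

/-- A cell and its translate by a unit vector are edge-adjacent. [folklore] -/
theorem cellAdj_add_cornerUnit (a : Site 2) (k : Fin 4) : CellAdj a (a + cornerUnit k) := by
  refine ⟨a + cornerOff (k + 1), k + 1, ?_, ?_⟩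
  · rw [faceAt]; abel
  · rw [fin4_add_one_add_three, faceAt, cornerUnit_eq_off_sub]; abel

/-- An edge through `w` is a dart edge at `w`. [folklore] -/
theorem exists_eq_dartEdge_of_mem {e : Sym2 (Site 2)} (he : e ∈ (zdGraph 2).edgeSet) {w : Site 2}
    (hw : w ∈ e) : ∃ k, e = dartEdge w k := by
  obtain ⟨w₀, k, rfl⟩ := exists_dartEdge_eq he
  rcases mem_dartEdge_iff.1 hw with rfl | rfl
  · exact ⟨k, rfl⟩
  · exact ⟨k + 2, (dartEdge_rev w₀ k).symm⟩

/-- The bond cell of the `m`-th side of `F` is the translate of the face cell by `u_{m+3}`. [folklore] -/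
theorem bcell_faceSide (F : Site 2) (m : Fin 4) : bcell (faceSide F m) = φc F + cornerUnit (m + 3) := by
  rw [faceSide, bcell_dartEdge]
  funext i
  simp only [βc_apply, Pi.add_apply, φc_apply]
  fin_cases i <;> fin_cases m <;> simp [cornerOff, cornerUnit] <;> ring

namespace TileData

variable (𝒯 : TileData)

/-- Symmetric closure step: adjacency in either direction gives a chain step. [folklore] -/
theorem reflTransGen_of_cellAdj {x y : Site 2} (hx : x ∈ 𝒯.U) (hy : y ∈ 𝒯.U)
    (h : CellAdj x y ∨ CellAdj y x) :
    Relation.ReflTransGen (fun a b => a ∈ 𝒯.U ∧ b ∈ 𝒯.U ∧ CellAdj a b) x y := by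
  rcases h with h | h
  · exact Relation.ReflTransGen.single ⟨hx, hy, h⟩
  · exact Relation.ReflTransGen.single ⟨hx, hy, h.symm⟩

/-- A site cell of `U` is chained to the bond cell of an accessible edge through it. [folklore] -/
theorem chain_σc_bcell {w : Site 2} {e : Sym2 (Site 2)} (he : e ∈ 𝒯.acc) (hw : w ∈ e) (hwO : w ∉ 𝒯.O) :
    Relation.ReflTransGen (fun a b => a ∈ 𝒯.U ∧ b ∈ 𝒯.U ∧ CellAdj a b) (σc w) (bcell e) := by
  obtain ⟨k, rfl⟩ := exists_eq_dartEdge_of_mem (𝒯.acc_edge e he) hw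
  have hS : σc w ∈ 𝒯.U := (σc_mem_U_iff 𝒯).2 ⟨hwO, _, he, hw⟩
  have hB : bcell (dartEdge w k) ∈ 𝒯.U := (𝒯.bcell_mem_U_iff (dartEdge_mem_edgeSet w k)).2 he
  rw [bcell_dartEdge] at hB ⊢
  exact 𝒯.reflTransGen_of_cellAdj hS hB (Or.inl (cellAdj_add_cornerUnit (σc w) k))

/-- The chain relation is symmetric. [folklore] -/
theorem chain_symm {x y : Site 2}
    (h : Relation.ReflTransGen (fun a b => a ∈ 𝒯.U ∧ b ∈ 𝒯.U ∧ CellAdj a b) x y) :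
    Relation.ReflTransGen (fun a b => a ∈ 𝒯.U ∧ b ∈ 𝒯.U ∧ CellAdj a b) y x := by
  induction h with
  | refl => exact Relation.ReflTransGen.refl
  | tail _ hst ih => exact (Relation.ReflTransGen.single ⟨hst.2.1, hst.1, hst.2.2.symm⟩).trans ih

/-- Bond cells of accessible edges are chained. [folklore] -/
theorem chain_bcell_bcell {e e' : Sym2 (Site 2)} (he : e ∈ 𝒯.acc) (he' : e' ∈ 𝒯.acc) :
    Relation.ReflTransGen (fun a b => a ∈ 𝒯.U ∧ b ∈ 𝒯.U ∧ CellAdj a b) (bcell e) (bcell e') := by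
  induction 𝒯.acc_conn e he e' he' with
  | refl => exact Relation.ReflTransGen.refl
  | tail _ hst ih =>
    obtain ⟨ha, hb, w, hwa, hwb, hwO⟩ := hst
    exact (ih ha).trans ((𝒯.chain_symm (𝒯.chain_σc_bcell ha hwa hwO)).trans (𝒯.chain_σc_bcell hb hwb hwO))

/-- **The tile domain is edge-connected.** [cite: SchrammSmirnov2011, proof of Thm 1.5 (C)] -/
theorem edgeConn : EdgeConn 𝒯.U := by
  -- every cell is chained to the bond cell of some accessible edge
  have key : ∀ c ∈ 𝒯.U, ∃ e ∈ 𝒯.acc,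
      Relation.ReflTransGen (fun a b => a ∈ 𝒯.U ∧ b ∈ 𝒯.U ∧ CellAdj a b) c (bcell e) := by
    classical
    intro c hc
    have hc' := hc
    simp only [U, Finset.mem_union, Finset.mem_image, Finset.mem_filter, mem_accVerts_iff] at hc'
    rcases hc' with ((⟨w, ⟨⟨e, he, hwe⟩, hwO⟩, rfl⟩ | ⟨e, he, rfl⟩) | ⟨f, hf, rfl⟩)
    · exact ⟨e, he, 𝒯.chain_σc_bcell he hwe hwO⟩
    · exact ⟨e, he, Relation.ReflTransGen.refl⟩
    · rw [mem_domFaces_iff] at hf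
      obtain ⟨hfD, e, he, hfe⟩ := hf
      obtain ⟨m, rfl⟩ := (isFaceOf_iff_exists_faceSide (𝒯.acc_edge _ he)).1 hfe
      refine ⟨_, he, ?_⟩
      have hF : φc f ∈ 𝒯.U := (φc_mem_U_iff 𝒯).2 ⟨hfD, _, he, hfe⟩
      have hB : bcell (faceSide f m) ∈ 𝒯.U := (𝒯.bcell_mem_U_iff (𝒯.acc_edge _ he)).2 he
      rw [bcell_faceSide] at hB ⊢
      exact 𝒯.reflTransGen_of_cellAdj hF hB (Or.inl (cellAdj_add_cornerUnit (φc f) (m + 3)))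
  intro a ha b hb
  obtain ⟨e, he, hae⟩ := key a ha
  obtain ⟨e', he', hbe'⟩ := key b hb
  exact hae.trans ((𝒯.chain_bcell_bcell he he').trans (𝒯.chain_symm hbe'))


/-! ### No holes: escapes of the out-cells -/

/-- Chains of out-cells. [folklore] -/
def OutChain (x y : Site 2) : Prop :=
  Relation.ReflTransGen (fun a b => a ∉ 𝒯.U ∧ b ∉ 𝒯.U ∧ CellAdj a b) x y

/-- One step of an out-chain, adjacency in either direction. [folklore] -/
theorem outChain_step {x y : Site 2} (hx : x ∉ 𝒯.U) (hy : y ∉ 𝒯.U) (h : CellAdj x y ∨ CellAdj y x) :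
    𝒯.OutChain x y := by
  rcases h with h | h
  · exact Relation.ReflTransGen.single ⟨hx, hy, h⟩
  · exact Relation.ReflTransGen.single ⟨hx, hy, h.symm⟩

/-- Out-chains compose. [folklore] -/
theorem OutChain.trans' {x y z : Site 2} (h1 : 𝒯.OutChain x y) (h2 : 𝒯.OutChain y z) : 𝒯.OutChain x z :=
  Relation.ReflTransGen.trans h1 h2

/-- Site cells of vertices outside the window are out. [folklore] -/
theorem σc_not_mem_of_not_mem_Wv {u : Site 2} (hu : u ∉ 𝒯.Wv) : σc u ∉ 𝒯.U := by
  rw [σc_mem_U_iff]; rintro ⟨-, e, he, hue⟩; exact hu (𝒯.acc_window e he u hue)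

/-- Site cells of hub vertices are out. [folklore] -/
theorem σc_not_mem_of_mem_O {v : Site 2} (hv : v ∈ 𝒯.O) : σc v ∉ 𝒯.U := by
  rw [σc_mem_U_iff]; exact fun h => h.1 hv

/-- Bond cells of dart edges with an endpoint outside the window are out. [folklore] -/
theorem βc_not_mem_of_not_mem_Wv {u : Site 2} {k : Fin 4} (hu : u ∉ 𝒯.Wv ∨ u + cornerUnit k ∉ 𝒯.Wv) :
    βc u k ∉ 𝒯.U := by
  rw [βc_mem_U_iff]
  intro h
  rcases hu with hu | hu
  · exact hu (𝒯.acc_window _ h u (mem_dartEdge_iff.2 (Or.inl rfl)))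
  · exact hu (𝒯.acc_window _ h _ (mem_dartEdge_iff.2 (Or.inr rfl)))

/-- Face cells of wet faces are out. [folklore] -/
theorem φc_not_mem_of_mem_D {f : Site 2} (hf : f ∈ 𝒯.Dset) : φc f ∉ 𝒯.U := by
  rw [φc_mem_U_iff]; exact fun h => h.1 hf

/-- The site cell of a vertex carrying a window pocket edge is out. [folklore] -/
theorem σc_not_mem_of_pocket {e : Sym2 (Site 2)} (heE : e ∈ (zdGraph 2).edgeSet)
    (hwin : ∀ v ∈ e, v ∈ 𝒯.Wv) (h1 : e ∉ 𝒯.hubE) (h2 : e ∉ 𝒯.clE) (h3 : e ∉ 𝒯.acc) {u : Site 2}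
    (hu : u ∈ e) : σc u ∉ 𝒯.U := by
  rw [σc_mem_U_iff]
  rintro ⟨huO, e', he', hue'⟩
  rcases 𝒯.closure e' he' u hue' huO e heE hu hwin with h | h | h
  · exact h1 h
  · exact h2 h
  · exact h3 h

/-- Bond cells of non-accessible lattice edges are out. [folklore] -/
theorem bcell_not_mem {e : Sym2 (Site 2)} (heE : e ∈ (zdGraph 2).edgeSet) (he : e ∉ 𝒯.acc) :
    bcell e ∉ 𝒯.U := by
  rw [𝒯.bcell_mem_U_iff heE]; exact he

end TileData

/-- The centre of a far site cell is far. [folklore] -/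
theorem norm_ctr_σc_ge (u : Site 2) : 2 * ‖Site.toComplex u‖ - 1 ≤ ‖ctr (σc u)‖ := by
  have h : ctr (σc u) = 2 * Site.toComplex u + ⟨1 / 2, 1 / 2⟩ := by
    apply Complex.ext <;> simp [ctr_re, ctr_im, two_mul]
  have hc : ‖(⟨1 / 2, 1 / 2⟩ : ℂ)‖ ≤ 1 := by
    rw [Complex.norm_def, Complex.normSq_mk, Real.sqrt_le_one]; norm_num
  rw [h]
  have := norm_sub_norm_le (2 * Site.toComplex u) (-⟨1 / 2, 1 / 2⟩)
  rw [sub_neg_eq_add, norm_neg] at this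
  have h2 : ‖(2 : ℂ) * Site.toComplex u‖ = 2 * ‖Site.toComplex u‖ := by rw [norm_mul]; norm_num
  linarith

namespace TileData

variable (𝒯 : TileData)

/-- Out-chain from a site cell to the bond cell of an edge at it. [folklore] -/
theorem outChain_σc_bcell {u : Site 2} {e : Sym2 (Site 2)} (heE : e ∈ (zdGraph 2).edgeSet) (hue : u ∈ e)
    (hσ : σc u ∉ 𝒯.U) (hB : bcell e ∉ 𝒯.U) : 𝒯.OutChain (σc u) (bcell e) := by
  obtain ⟨k, rfl⟩ := exists_eq_dartEdge_of_mem heE hue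
  rw [bcell_dartEdge] at hB ⊢
  exact 𝒯.outChain_step hσ hB (Or.inl (cellAdj_add_cornerUnit _ k))

/-- Out-chain from the bond cell of an edge to a site cell at it. [folklore] -/
theorem outChain_bcell_σc {u : Site 2} {e : Sym2 (Site 2)} (heE : e ∈ (zdGraph 2).edgeSet) (hue : u ∈ e)
    (hB : bcell e ∉ 𝒯.U) (hσ : σc u ∉ 𝒯.U) : 𝒯.OutChain (bcell e) (σc u) := by
  obtain ⟨k, rfl⟩ := exists_eq_dartEdge_of_mem heE hue
  rw [bcell_dartEdge] at hB ⊢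
  exact 𝒯.outChain_step hB hσ (Or.inr (cellAdj_add_cornerUnit _ k))

/-- **Marching off**: from a vertex outside the window, an out-chain to arbitrarily far cells. [folklore] -/
theorem escape_W {u : Site 2} (hu : u ∉ 𝒯.Wv) (R : ℝ) : ∃ o, R < ‖ctr o‖ ∧ 𝒯.OutChain (σc u) o := by
  obtain ⟨u', hfar, hwalk⟩ := 𝒯.esc_W u hu ((R + 1) / 2)
  refine ⟨σc u', by linarith [norm_ctr_σc_ge u'], ?_⟩
  clear hfar
  induction hwalk with
  | refl => exact Relation.ReflTransGen.refl
  | tail _ hst ih =>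
    obtain ⟨ha, hb, k, rfl⟩ := hst
    refine ih.trans ((𝒯.outChain_step (𝒯.σc_not_mem_of_not_mem_Wv ha)
      (𝒯.βc_not_mem_of_not_mem_Wv (Or.inl ha)) (Or.inl (cellAdj_add_cornerUnit (σc _) k))).trans
      (𝒯.outChain_step (𝒯.βc_not_mem_of_not_mem_Wv (Or.inl ha)) (𝒯.σc_not_mem_of_not_mem_Wv hb)
        (Or.inl ?_)))
    rw [σc_add_cornerUnit]; exact cellAdj_add_cornerUnit _ k

end TileData

/-- The second endpoint of a dart presentation of a lattice edge `s(b, c)`. [folklore] -/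
theorem eq_add_cornerUnit_of_mk_eq_dartEdge {b c : Site 2} {k : Fin 4} (hbc : s(b, c) ∈ (zdGraph 2).edgeSet)
    (hk : s(b, c) = dartEdge b k) : c = b + cornerUnit k := by
  have : c ∈ dartEdge b k := by rw [← hk]; exact Sym2.mem_mk_right _ _
  rcases mem_dartEdge_iff.1 this with h | h
  · exfalso
    rw [h] at hbc
    exact ((SimpleGraph.mem_edgeSet _).1 hbc).ne rfl
  · exact h

namespace TileData

variable (𝒯 : TileData)

/-- **Hub escape**: from the site cell of a hub vertex, an out-chain to arbitrarily far cells. [folklore] -/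
theorem escape_O {v : Site 2} (hv : v ∈ 𝒯.O) (R : ℝ) : ∃ o, R < ‖ctr o‖ ∧ 𝒯.OutChain (σc v) o := by
  obtain ⟨u, hu, hwalk⟩ := 𝒯.esc_O v hv
  obtain ⟨o, ho, hchain⟩ := 𝒯.escape_W hu R
  refine ⟨o, ho, Relation.ReflTransGen.trans ?_ hchain⟩
  clear hchain ho hu
  induction hwalk with
  | refl => exact Relation.ReflTransGen.refl
  | tail _ hst ih =>
    have hedge := 𝒯.hub_edge _ hst
    have hbO := 𝒯.hub_O _ hst _ (Sym2.mem_mk_left _ _)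
    have hcO := 𝒯.hub_O _ hst _ (Sym2.mem_mk_right _ _)
    have hB := 𝒯.bcell_not_mem hedge fun h => 𝒯.acc_not_hub _ h hst
    exact ih.trans ((𝒯.outChain_σc_bcell hedge (Sym2.mem_mk_left _ _) (𝒯.σc_not_mem_of_mem_O hbO) hB).trans
      (𝒯.outChain_bcell_σc hedge (Sym2.mem_mk_right _ _) hB (𝒯.σc_not_mem_of_mem_O hcO)))

end TileData

/-- From a face cell to the bond cell of one of its sides. [folklore] -/
theorem cellAdj_φc_bcell {f : Site 2} {c : Sym2 (Site 2)} (hc : c ∈ (zdGraph 2).edgeSet) (hf : IsFaceOf f c) :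
    CellAdj (φc f) (bcell c) := by
  obtain ⟨m, rfl⟩ := (isFaceOf_iff_exists_faceSide hc).1 hf
  rw [bcell_faceSide]; exact cellAdj_add_cornerUnit _ _

namespace TileData

variable (𝒯 : TileData)

/-- **Wet escape**: from the face cell of a wet face, an out-chain to arbitrarily far cells. [folklore] -/
theorem escape_D {f : Site 2} (hf : f ∈ 𝒯.Dset) (R : ℝ) : ∃ o, R < ‖ctr o‖ ∧ 𝒯.OutChain (φc f) o := by
  obtain ⟨g, hgcorner, hwalk⟩ := 𝒯.esc_D f hf
  -- the dual walk as an out-chain, keeping track of wetness of the current face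
  have key : 𝒯.OutChain (φc f) (φc g) ∧ g ∈ 𝒯.Dset := by
    clear hgcorner
    induction hwalk with
    | refl => exact ⟨Relation.ReflTransGen.refl, hf⟩
    | tail _ hst ih =>
      obtain ⟨hbD, c, hc, hcE, hfa, hfb⟩ := hst
      obtain ⟨hchain', haD⟩ := ih
      have hB : bcell c ∉ 𝒯.U := 𝒯.bcell_not_mem hcE fun h => 𝒯.acc_not_cl _ h hc
      exact ⟨hchain'.trans ((𝒯.outChain_step (𝒯.φc_not_mem_of_mem_D haD) hB
        (Or.inl (cellAdj_φc_bcell hcE hfa))).trans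
        (𝒯.outChain_step hB (𝒯.φc_not_mem_of_mem_D hbD) (Or.inr (cellAdj_φc_bcell hcE hfb)))), hbD⟩
  obtain ⟨hfg, hg⟩ := key
  obtain ⟨u, hu, hug⟩ := hgcorner
  obtain ⟨o, ho, hchain⟩ := 𝒯.escape_W hu R
  refine ⟨o, ho, ?_⟩
  -- from `φc g` to `σc u` through the side of `g` at `u`
  obtain ⟨j, rfl⟩ := exists_faceAt_of_isCorner (v := u) (f := g) hug
  have hside : IsFaceOf (faceAt u j) (dartEdge u j) := isFaceOf_dartEdge_iff.2 (Or.inl rfl)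
  have hB : βc u j ∉ 𝒯.U := 𝒯.βc_not_mem_of_not_mem_Wv (Or.inl hu)
  have h1 : 𝒯.OutChain (φc (faceAt u j)) (βc u j) := by
    have := cellAdj_φc_bcell (dartEdge_mem_edgeSet u j) hside
    rw [bcell_dartEdge] at this
    exact 𝒯.outChain_step (𝒯.φc_not_mem_of_mem_D hg) hB (Or.inl this)
  have h2 : 𝒯.OutChain (βc u j) (σc u) :=
    𝒯.outChain_step hB (𝒯.σc_not_mem_of_not_mem_Wv hu) (Or.inr (cellAdj_add_cornerUnit _ j))
  exact hfg.trans (h1.trans (h2.trans hchain))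

/-- **Closed-edge escape**: from the bond cell of an examined closed edge. [folklore] -/
theorem escape_cl {c : Sym2 (Site 2)} (hc : c ∈ 𝒯.clE) (hcE : c ∈ (zdGraph 2).edgeSet) (R : ℝ) :
    ∃ o, R < ‖ctr o‖ ∧ 𝒯.OutChain (bcell c) o := by
  obtain ⟨a, b, -, hab⟩ := exists_dualEdge_eq_mk hcE
  have hfa : IsFaceOf a c := isFaceOf_left_of_dualEdge_eq hab
  have haD : a ∈ 𝒯.Dset := 𝒯.cl_D c hc a hfa
  obtain ⟨o, ho, hchain⟩ := 𝒯.escape_D haD R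
  have hB : bcell c ∉ 𝒯.U := 𝒯.bcell_not_mem hcE fun h => 𝒯.acc_not_cl _ h hc
  exact ⟨o, ho, (𝒯.outChain_step hB (𝒯.φc_not_mem_of_mem_D haD) (Or.inr (cellAdj_φc_bcell hcE hfa))).trans hchain⟩

/-- **Pocket escape**: from the bond cell of a window pocket edge. [folklore] -/
theorem escape_pocket {e : Sym2 (Site 2)} (heE : e ∈ (zdGraph 2).edgeSet) (hwin : ∀ v ∈ e, v ∈ 𝒯.Wv)
    (hh : e ∉ 𝒯.hubE) (hcl : e ∉ 𝒯.clE) (hacc : e ∉ 𝒯.acc) (R : ℝ) :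
    ∃ o, R < ‖ctr o‖ ∧ 𝒯.OutChain (bcell e) o := by
  obtain ⟨e', u, hue', hend, hwalk⟩ := 𝒯.esc_P e heE hwin hh hcl hacc
  -- the pocket walk
  have key : 𝒯.OutChain (bcell e) (bcell e') ∧ e' ∈ (zdGraph 2).edgeSet ∧ (∀ v ∈ e', v ∈ 𝒯.Wv) ∧
      e' ∉ 𝒯.hubE ∧ e' ∉ 𝒯.clE ∧ e' ∉ 𝒯.acc := by
    clear hue' hend
    induction hwalk with
    | refl => exact ⟨Relation.ReflTransGen.refl, heE, hwin, hh, hcl, hacc⟩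
    | tail _ hst ih =>
      obtain ⟨hbE, hbwin, hbh, hbcl, hbacc, w, hwa, hwb⟩ := hst
      obtain ⟨hchain, haE, hawin, hah, hacl', haacc⟩ := ih
      have hσ : σc w ∉ 𝒯.U := 𝒯.σc_not_mem_of_pocket haE hawin hah hacl' haacc hwa
      have hBa : bcell _ ∉ 𝒯.U := 𝒯.bcell_not_mem haE haacc
      have hBb : bcell _ ∉ 𝒯.U := 𝒯.bcell_not_mem hbE hbacc
      exact ⟨hchain.trans ((𝒯.outChain_bcell_σc haE hwa hBa hσ).trans (𝒯.outChain_σc_bcell hbE hwb hσ hBb)),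
        hbE, hbwin, hbh, hbcl, hbacc⟩
  obtain ⟨hchain, he'E, he'win, he'h, he'cl, he'acc⟩ := key
  have hσu : σc u ∉ 𝒯.U := 𝒯.σc_not_mem_of_pocket he'E he'win he'h he'cl he'acc hue'
  have hBe' : bcell e' ∉ 𝒯.U := 𝒯.bcell_not_mem he'E he'acc
  have hto_u : 𝒯.OutChain (bcell e) (σc u) := hchain.trans (𝒯.outChain_bcell_σc he'E hue' hBe' hσu)
  rcases hend with huO | ⟨c, hc, hcE, huc⟩ | ⟨k, hk⟩
  · obtain ⟨o, ho, h⟩ := 𝒯.escape_O huO R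
    exact ⟨o, ho, hto_u.trans h⟩
  · obtain ⟨o, ho, h⟩ := 𝒯.escape_cl hc hcE R
    have hBc : bcell c ∉ 𝒯.U := 𝒯.bcell_not_mem hcE fun h' => 𝒯.acc_not_cl _ h' hc
    exact ⟨o, ho, hto_u.trans ((𝒯.outChain_σc_bcell hcE huc hσu hBc).trans h)⟩
  · obtain ⟨o, ho, h⟩ := 𝒯.escape_W hk R
    have hB : βc u k ∉ 𝒯.U := 𝒯.βc_not_mem_of_not_mem_Wv (Or.inr hk)
    refine ⟨o, ho, hto_u.trans ((𝒯.outChain_step hσu hB (Or.inl (cellAdj_add_cornerUnit _ k))).trans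
      ((𝒯.outChain_step hB (𝒯.σc_not_mem_of_not_mem_Wv hk) (Or.inl ?_)).trans h))⟩
    rw [σc_add_cornerUnit]; exact cellAdj_add_cornerUnit _ k

/-- **Bond escape**: from the bond cell of any non-accessible lattice edge. [folklore] -/
theorem escape_edge {e : Sym2 (Site 2)} (heE : e ∈ (zdGraph 2).edgeSet) (he : e ∉ 𝒯.acc) (R : ℝ) :
    ∃ o, R < ‖ctr o‖ ∧ 𝒯.OutChain (bcell e) o := by
  have hB : bcell e ∉ 𝒯.U := 𝒯.bcell_not_mem heE he
  by_cases hwin : ∀ v ∈ e, v ∈ 𝒯.Wv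
  · by_cases hh : e ∈ 𝒯.hubE
    · obtain ⟨w, k, rfl⟩ := exists_dartEdge_eq heE
      have hwO : w ∈ 𝒯.O := 𝒯.hub_O _ hh w (mem_dartEdge_iff.2 (Or.inl rfl))
      obtain ⟨o, ho, hchain⟩ := 𝒯.escape_O hwO R
      exact ⟨o, ho, (𝒯.outChain_bcell_σc heE (mem_dartEdge_iff.2 (Or.inl rfl)) hB
        (𝒯.σc_not_mem_of_mem_O hwO)).trans hchain⟩
    by_cases hcl : e ∈ 𝒯.clE
    · exact 𝒯.escape_cl hcl heE R
    · exact 𝒯.escape_pocket heE hwin hh hcl he R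
  · push Not at hwin
    obtain ⟨u, hue, hu⟩ := hwin
    obtain ⟨o, ho, hchain⟩ := 𝒯.escape_W hu R
    exact ⟨o, ho, (𝒯.outChain_bcell_σc heE hue hB (𝒯.σc_not_mem_of_not_mem_Wv hu)).trans hchain⟩

/-! ### No holes -/

end TileData

/-- Every cell is a site, bond or face cell. [folklore] -/
theorem cell_trichotomy (o : Site 2) :
    (∃ v, o = σc v) ∨ (∃ w k, o = βc w k) ∨ ∃ f, o = φc f := by
  obtain ⟨v, j, hv⟩ := exists_corner_eq o
  -- `o = 2v + cornerOff j`
  fin_cases j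
  · left; exact ⟨v, by rw [hv]; simp [cornerOff]⟩
  · right; left; refine ⟨v, 0, ?_⟩; rw [hv, βc_eq]; rfl
  · right; right; refine ⟨v, ?_⟩; rw [hv, φc, σc]; rfl
  · right; left; refine ⟨v, 1, ?_⟩; rw [hv, βc_eq]; rfl

/-- Cells adjacent to a site cell are the bond cells at that vertex. [folklore] -/
theorem eq_βc_of_cellAdj_σc {v o : Site 2} (h : CellAdj (σc v) o ∨ CellAdj o (σc v)) : ∃ k, o = βc v k := by
  have key : ∀ {a b : Site 2}, CellAdj a b → ∃ k, b = a + cornerUnit k := by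
    rintro a b ⟨x, k, rfl, rfl⟩
    refine ⟨k + 3, ?_⟩
    rw [faceAt, faceAt, cornerUnit_eq_off_sub, fin4_add_three_add_one]; abel
  rcases h with h | h
  · obtain ⟨k, hk⟩ := key h
    exact ⟨k, by rw [hk, βc_eq]⟩
  · obtain ⟨k, hk⟩ := key h
    refine ⟨k + 2, ?_⟩
    rw [βc_eq, cornerUnit_add_two]
    have : o = σc v - cornerUnit k := by rw [hk]; abel
    rw [this]; abel

/-- Cells adjacent to a bond cell `βc w k`: the two site cells and the two face cells. [folklore] -/
theorem cellAdj_βc_cases {w : Site 2} {k : Fin 4} {o : Site 2} (h : CellAdj (βc w k) o ∨ CellAdj o (βc w k)) :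
    o = σc w ∨ o = σc (w + cornerUnit k) ∨ ∃ f, o = φc f ∧ IsFaceOf f (dartEdge w k) := by
  have key : ∀ {a b : Site 2}, (CellAdj a b ∨ CellAdj b a) → ∃ m, b = a + cornerUnit m := by
    rintro a b (⟨x, m, rfl, rfl⟩ | ⟨x, m, rfl, rfl⟩)
    · refine ⟨m + 3, ?_⟩
      rw [faceAt, faceAt, cornerUnit_eq_off_sub, fin4_add_three_add_one]; abel
    · refine ⟨m + 1, ?_⟩
      rw [faceAt, faceAt, cornerUnit_succ_eq]; abel
  obtain ⟨m, rfl⟩ := key h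
  obtain ⟨i, rfl⟩ := fin4_exists_add k m
  fin_cases i
  · -- `m = k`: next site cell
    right; left
    simp only [Fin.zero_eta, add_zero]
    rw [βc_eq, σc_add_cornerUnit]
  · -- `m = k + 1`: the left face
    right; right
    refine ⟨faceAt w k, ?_, isFaceOf_dartEdge_iff.2 (Or.inl rfl)⟩
    simp only [Fin.mk_one]
    funext i
    simp only [Pi.add_apply, βc_apply, φc_apply, faceAt, Pi.sub_apply]
    fin_cases i <;> fin_cases k <;> simp [cornerUnit, cornerOff] <;> ring
  · -- `m = k + 2`: back to the site cell
    left
    simp only [Fin.reduceFinMk]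
    rw [βc_eq, cornerUnit_add_two]; abel
  · -- `m = k + 3`: the right face
    right; right
    refine ⟨faceAt w (k + 3), ?_, isFaceOf_dartEdge_iff.2 (Or.inr rfl)⟩
    simp only [Fin.reduceFinMk]
    funext i
    simp only [Pi.add_apply, βc_apply, φc_apply, faceAt, Pi.sub_apply]
    fin_cases i <;> fin_cases k <;> simp [cornerUnit, cornerOff] <;> ring

/-- Cells adjacent to a face cell are the bond cells of its sides. [folklore] -/
theorem eq_bcell_of_cellAdj_φc {f o : Site 2} (h : CellAdj (φc f) o ∨ CellAdj o (φc f)) :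
    ∃ m, o = bcell (faceSide f m) := by
  have key : ∀ {a b : Site 2}, (CellAdj a b ∨ CellAdj b a) → ∃ m, b = a + cornerUnit m := by
    rintro a b (⟨x, m, rfl, rfl⟩ | ⟨x, m, rfl, rfl⟩)
    · refine ⟨m + 3, ?_⟩
      rw [faceAt, faceAt, cornerUnit_eq_off_sub, fin4_add_three_add_one]; abel
    · refine ⟨m + 1, ?_⟩
      rw [faceAt, faceAt, cornerUnit_succ_eq]; abel
  obtain ⟨m, rfl⟩ := key h
  exact ⟨m + 1, by rw [bcell_faceSide, fin4_add_one_add_three]⟩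

namespace TileData

variable (𝒯 : TileData)

/-- **The tile domain has no holes.** [cite: SchrammSmirnov2011, proof of Thm 1.5 (C)] -/
theorem coHoleFree : CoHoleFree 𝒯.U := by
  intro o ho hadj R
  obtain ⟨c, hc, hco⟩ := hadj
  -- classify the out-cell
  rcases cell_trichotomy o with ⟨v, rfl⟩ | ⟨w, k, rfl⟩ | ⟨f, rfl⟩
  · -- a site cell: adjacent in-cell is a bond cell of an accessible edge at `v`, so `v ∈ O`
    obtain ⟨k, rfl⟩ := eq_βc_of_cellAdj_σc (Or.inr hco)
    rw [βc_mem_U_iff] at hc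
    have hvO : v ∈ 𝒯.O := by
      by_contra hvO
      exact ho ((σc_mem_U_iff 𝒯).2 ⟨hvO, _, hc, mem_dartEdge_iff.2 (Or.inl rfl)⟩)
    exact 𝒯.escape_O hvO R
  · -- a bond cell of a non-accessible edge
    have he : dartEdge w k ∉ 𝒯.acc := by rwa [← βc_mem_U_iff]
    obtain ⟨o', ho', h⟩ := 𝒯.escape_edge (dartEdge_mem_edgeSet w k) he R
    exact ⟨o', ho', by rwa [bcell_dartEdge] at h⟩
  · -- a face cell: adjacent in-cell is the bond cell of an accessible side, so the face is wet
    obtain ⟨m, rfl⟩ := eq_bcell_of_cellAdj_φc (Or.inr hco)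
    have he : faceSide f m ∈ 𝒯.acc := (𝒯.bcell_mem_U_iff (dartEdge_mem_edgeSet _ _)).1 hc
    have hfD : f ∈ 𝒯.Dset := by
      by_contra hfD
      exact ho ((φc_mem_U_iff 𝒯).2 ⟨hfD, _, he, (isFaceOf_iff_exists_faceSide (dartEdge_mem_edgeSet _ _)).2 ⟨m, rfl⟩⟩)
    exact 𝒯.escape_D hfD R


end TileData

end CellComplex

end Literature.Probability.Percolation

end
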